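/-
Copyright: the b2b-balaban T⁴-continuum CRUX team, row NE7b OWNER lineage `t4-ne7b-p1` (gen 129). Project licence.
-/
import Summits.QuantumFields.BalabanUV.T4Continuum.Spine.NE7b.SupAllFieldAssembly
import Summits.QuantumFields.BalabanUV.T4Continuum.Spine.NE7b.SupLargeFieldPenaltyPaid
import Mathlib.MeasureTheory.Integral.Prod

/-!
# THE TWO-SCALE THEOREM — THE LOGARITHM OF THE FLUCTUATION STEP HAS AN EXTENSIVE EXPONENTIAL MOMENT UNDER THE NEXT GAUSSIAN: for the
# road's step `Z_ψ(C) = ∫e^{−Σ_{p∈C}Σ_{x∈cell p}w_x(ω_x+ψ_x)}dN(0,Γ)(ω)` and the next field `ψ ∼ N(0,Γ')` with a regulator margin `κ'`,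
#   `∫ e^{t·|log Z_ψ(C)|} dN(0,Γ')(ψ) ≤ exp(#C·(t·(2d₁ + ½d₂) + e^{t·c₂v∕2}·e^{−(κ'∕2 − tκ₀(1+τ⁻¹))Ψ²}·A'^v))`
# — `O(ε)` per cell from the small-field region at EVERY `ψ` ((307), thresholding the cells of `C` at `Σ_{cell p}ψ² ≤ Ψ²`) plus `O(η')` per cell
# from the large-field cells, whose quadratic penalty is PAID by their Gaussian rarity at the next scale ((308)); no volume factor, no hole
# polymer, no locality input between the regions (row NE7b, node U5c; (307) + (308) BY NAME + Mathlib's `StronglyMeasurable.integral_prod_right'`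
# for the measurability of `ψ ↦ Z_ψ(C)`; [folklore])

Cell `pub-balaban`, sub-cell `t4`, spine estimate NE7b (`T4WeightBudget.RelWeightBound`; the cell's OWN estimate — NOT PRINTED in
[Bałaban 1983–89], NOT PROVED).  Crux-route work under `Spine/NE7b/` by the row OWNER (`t4-ne7b-p1` gen 129, file (309)) under FREEZE
(0)'s crux-prover clause, on § [NE7bP1-G128-HANDOFF] NEXT (3)(a)+(b) («the all-ψ assembly … paid by (294)'s weights»); NOTHING of Bałaban's
is named as a Lean object, valued or asserted; no `T4Continuum/Support` leaf typed; no `def`, no notation; zero `sorry`.  Imports (BY NAME):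
the OWNER's (307) `…SupAllFieldAssembly` (`log_integral_allField_le`, `le_log_integral_allField`), (306) (`cellSum_eq_sum_biUnion`,
`measurable_cellSum`), (308) `…SupLargeFieldPenaltyPaid` (`integral_prod_one_add_cellWeight_le_exp`, `integrable_prod_cellWeight`), (297)
(`integrable_exp_neg`); Mathlib's `Finset.filter_union_filter_not_eq`, `Finset.disjoint_filter_filter_not`, `Finset.card_biUnion`,
`Finset.prod_filter`, `Finset.prod_one_add`, `Real.exp_sum`, `MeasureTheory.StronglyMeasurable.integral_prod_right'`,
`integral_mono_of_nonneg`.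

WHY (located; DECISION SCOPING-d3).  (307) is a bound at FIXED `ψ` whose large-field part grows quadratically in `ψ` on the cells where
`ψ` is large; the multiscale bookkeeping needs this growth to be harmless when `ψ` is integrated at the next scale.  Thresholding the cells of
`C` by `ψ` itself (`S(ψ)`, `L(ψ)`), exponentiating, and bounding `e^{Σ_{p∈L(ψ)}(a+bΣ_{cell p}ψ²)} ≤ ∏_{p∈C}(1 + 1_{p large}e^{a}e^{bΣ_{cell p}ψ²})`
puts the step in (308)'s resummed form: the penalty is an extensive `O(η')`, `η'` exponentially small in `κ'Ψ²`.

WHAT IS PROVED ([folklore]; `Γ, Γ' ⪰ 0` on `ι`, cells pairwise disjoint of `≤ v` sites, `R` symmetric covering the range of `Γ` with `≤ Δ`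
neighbours, remainders measurable with `|w_x(t)| ≤ κ₀t²` (two-sided) and `|w_x(t)| ≤ c₃|t|³` on `|t| ≤ h`, `4κ₀ ≤ κ`, `κ(1+τ)γ_op ≤ θ < 1`,
`d_t = (Δ+1)·2e·ε_tA_τ^v` the per-cell densities of (307) at couplings `t = 1, 2`, `c₂ = (4κ₀(1+τ)γ∕(2θ))·(−log(1−θ))`):
* §1 AT EVERY `ψ`: **`abs_log_step_le`** — `|log Z_ψ(C)| ≤ #C·(2d₁ + ½d₂) + Σ_{p∈C, Σ_{cell p}ψ² > Ψ²}(½c₂v + κ₀(1+τ⁻¹)Σ_{x∈cell p}ψ_x²)`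
  ((307) with `S = S(ψ)`, `L = L(ψ)`; `#S ≤ #C`, `#⋃L = Σ_{p∈L}#cell p ≤ v#L`);
* §2 **`exp_mul_abs_log_step_le`** (`t ≥ 0`): `e^{t|log Z_ψ(C)|} ≤ e^{t(2d₁+½d₂)#C}·∏_{p∈C}(1 + 1_{Ψ²≤Σ_{cell p}ψ²}·e^{tc₂v∕2}·e^{tκ₀(1+τ⁻¹)Σ_{cell p}ψ²})`;
* §3 `measurable_step` (`ψ ↦ Z_ψ(C)` is measurable — Fubini measurability of a jointly measurable integrand), `integrable_prod_one_add_cellWeight`,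
  `integrable_exp_mul_abs_log_step` (the moment's integrand is integrable under `N(0,Γ')` when `tκ₀(1+τ⁻¹) ≤ κ'∕2`, `κ'γ'_op ≤ θ' < 1`);
* §4 THE END **`integral_exp_mul_abs_log_step_le`**:
  `∫ e^{t|log Z_ψ(C)|} dN(0,Γ')(ψ) ≤ exp(#C·(t(2d₁ + ½d₂) + e^{tc₂v∕2}·e^{−(κ'∕2−tκ₀(1+τ⁻¹))Ψ²}·A'^v))`, `A' = (1−θ')^{−κ'γ'∕(2θ')}`; §5 toy.

HONEST (what this is NOT).  Two Gaussian scales of the scalar road with the next field on the SAME sites and the SAME cells (no blocking map,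
no renormalisation of `κ`, no extraction of relevant terms): the penalty bookkeeping only; the iteration along (280)'s scales is (310);
scalar skeleton ((A3), NC-NE7b-α UNRULED); nothing of Bałaban's asserted.  BY-NAME EFFECT ON THE WALL: NONE.  NE7b NOT PRINTED ∕ NOT PROVED;
spine PROVED 0∕9; rung (B)+1 — the programme's measures remain FINITE-torus statements; NOT the mass gap, NOT Clay.  HONEST DEPENDENCY:
continuum YM on T⁴ ⇐ BetaPertH ∧ nine spine estimates (0∕9 proved); BetaPertH ⇐ (D1) ∧ (D4) ∧ CAP+tail; G-an2-4 gates asym, D1 and NE2∕3∕4.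
-/

set_option autoImplicit false

noncomputable section

namespace Summit.QuantumFields.BalabanUV.T4Continuum.NE7b.SupStepExponentialMoments

open MeasureTheory ProbabilityTheory Finset Real
open scoped BigOperators
open Literature.Analysis.Matrix (HasFiniteRange)
open SupAllFieldAssembly (log_integral_allField_le le_log_integral_allField)
open SupSmallFieldGasReal (cellSum_eq_sum_biUnion measurable_cellSum)
open SupLargeFieldPenaltyPaid (integral_prod_one_add_cellWeight_le_exp integrable_prod_cellWeight measurable_indicator_largeCells
  measurable_exp_mul_sum_sq)
open SupFluctuationAPriori (integrable_exp_neg)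

variable {ι : Type} [Fintype ι] [DecidableEq ι] {V : Type*} [DecidableEq V]

section Step

variable {Γ : Matrix ι ι ℝ} {γop γ : ℝ} {dι : ι → ι → ℕ} {ρ : ℕ} {cell : V → Finset ι} {v : ℕ} {R : V → V → Prop}
  [DecidableRel R] [Std.Symm R] {nbr : V → Finset V} {Δ : ℕ} {w : ι → ℝ → ℝ} {κ₀ c₃ h κ τ θ Ψ : ℝ}

/-! ## §1. At every external field: thresholding the cells of `C` -/

/-- **AT EVERY `ψ` — THE STEP'S LOGARITHM IS `O(ε)·#C` PLUS A QUADRATIC CHARGE ON THE CELLS WHERE `ψ` IS LARGE.**  `Γ ⪰ 0` of range `ρ`,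
`Γ ⪯ γ_op·1`, diagonal `≤ γ` (`γ ≥ 0`); disjoint cells of `≤ v` sites; `R` symmetric covering `ρ`-closeness with `≤ Δ` neighbours; measurable
remainders with `−κ₀t² ≤ w_x(t) ≤ κ₀t²` (`κ₀ ≥ 0`) and `|w_x(t)| ≤ c₃|t|³` for `|t| ≤ h` (`c₃, h ≥ 0`); `4κ₀ ≤ κ`, `0 < τ`, `0 < θ < 1`,
`κ(1+τ)γ_op ≤ θ`; the smallness conditions of (307) at couplings `1` and `2` ⟹ for EVERY finite cell set `C` and EVERY `ψ`:
`|log Z_ψ(C)| ≤ #C·(2d₁ + ½d₂) + Σ_{p∈C, ¬(Σ_{cell p}ψ² ≤ Ψ²)}(½c₂v + κ₀(1+τ⁻¹)Σ_{x∈cell p}ψ_x²)`. [folklore] -/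
theorem abs_log_step_le (hΓ : Γ.PosSemidef) (hΓop : (γop • (1 : Matrix ι ι ℝ) - Γ).PosSemidef) (hdiag : ∀ i, Γ i i ≤ γ)
    (hγ : 0 ≤ γ) (hfr : HasFiniteRange dι ρ Γ) (hdisj : ∀ p q, p ≠ q → Disjoint (cell p) (cell q)) (hv : ∀ p, (cell p).card ≤ v)
    (hR : ∀ (p p' : V) (x y : ι), x ∈ cell p → y ∈ cell p' → dι x y ≤ ρ → p = p' ∨ R p p')
    (hΔ : ∀ x, (nbr x).card ≤ Δ) (hnbr : ∀ x y, R x y → y ∈ nbr x) (hw : ∀ x, Measurable (w x)) (hκ₀ : 0 ≤ κ₀) (hc₃ : 0 ≤ c₃)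
    (hh : 0 ≤ h) (hstab : ∀ x, ∀ t : ℝ, -(κ₀ * t ^ 2) ≤ w x t) (hquad : ∀ x, ∀ t : ℝ, w x t ≤ κ₀ * t ^ 2)
    (hcub : ∀ x, ∀ t : ℝ, |t| ≤ h → |w x t| ≤ c₃ * |t| ^ 3) (hκ : 4 * κ₀ ≤ κ) (hτ : 0 < τ) (hθ0 : 0 < θ) (hθ1 : θ < 1)
    (hκθ : κ * (1 + τ) * γop ≤ θ)
    (hsmall₁ : Real.exp 1 * (((max (exp (c₃ * v * h ^ 3) - 1) (2 * exp (-((κ / 2 - κ₀) * h ^ 2)))) *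
      exp (κ * (1 + τ⁻¹) * Ψ ^ 2 / 2)) * ((1 - θ) ^ (-(κ * (1 + τ) * γ / (2 * θ)))) ^ v) * ((Δ : ℝ) + 1) ^ 2 ≤ 1 / 2)
    (hsmall₂ : Real.exp 1 * (((max (exp (2 * c₃ * v * h ^ 3) - 1) (2 * exp (-((κ / 2 - 2 * κ₀) * h ^ 2)))) *
      exp (κ * (1 + τ⁻¹) * Ψ ^ 2 / 2)) * ((1 - θ) ^ (-(κ * (1 + τ) * γ / (2 * θ)))) ^ v) * ((Δ : ℝ) + 1) ^ 2 ≤ 1 / 2)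
    (C : Finset V) (ψ : EuclideanSpace ℝ ι) :
    |log (∫ ω : EuclideanSpace ℝ ι, exp (-(∑ p ∈ C, ∑ x ∈ cell p, w x (ω x + ψ x))) ∂(multivariateGaussian 0 Γ))| ≤
      C.card * (2 * (((Δ : ℝ) + 1) * (2 * (Real.exp 1 * (((max (exp (c₃ * v * h ^ 3) - 1) (2 * exp (-((κ / 2 - κ₀) * h ^ 2)))) *
          exp (κ * (1 + τ⁻¹) * Ψ ^ 2 / 2)) * ((1 - θ) ^ (-(κ * (1 + τ) * γ / (2 * θ)))) ^ v)))) +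
        (1 / 2) * (((Δ : ℝ) + 1) * (2 * (Real.exp 1 * (((max (exp (2 * c₃ * v * h ^ 3) - 1)
          (2 * exp (-((κ / 2 - 2 * κ₀) * h ^ 2)))) * exp (κ * (1 + τ⁻¹) * Ψ ^ 2 / 2)) *
          ((1 - θ) ^ (-(κ * (1 + τ) * γ / (2 * θ)))) ^ v))))) +
      ∑ p ∈ C with ¬ (∑ x ∈ cell p, ψ x ^ 2 ≤ Ψ ^ 2),
        ((1 / 2) * ((2 * (2 * κ₀) * (1 + τ) * γ / (2 * θ)) * (-log (1 - θ))) * v + κ₀ * (1 + τ⁻¹) * ∑ x ∈ cell p, ψ x ^ 2) := by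
  -- the threshold split of the cells of `C`
  set S : Finset V := C.filter (fun p => ∑ x ∈ cell p, ψ x ^ 2 ≤ Ψ ^ 2) with hS
  set L : Finset V := C.filter (fun p => ¬ (∑ x ∈ cell p, ψ x ^ 2 ≤ Ψ ^ 2)) with hL
  have hSL : Disjoint S L := disjoint_filter_filter_not C C _
  have hunion : S ∪ L = C := filter_union_filter_not_eq _ C
  have hψS : ∀ p ∈ S, ∑ x ∈ cell p, ψ x ^ 2 ≤ Ψ ^ 2 := fun p hp => (mem_filter.1 hp).2
  have hSC : (S.card : ℝ) ≤ C.card := by exact_mod_cast card_filter_le _ _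
  -- the sign bookkeeping for the stability constant at the negative coupling
  have hκ₁θ : 4 * κ₀ * (1 + τ) * γop ≤ θ := by
    rcases le_or_gt 0 ((1 + τ) * γop) with hpos | hneg
    · calc 4 * κ₀ * (1 + τ) * γop = (4 * κ₀) * ((1 + τ) * γop) := by ring
        _ ≤ κ * ((1 + τ) * γop) := mul_le_mul_of_nonneg_right hκ hpos
        _ = κ * (1 + τ) * γop := by ring
        _ ≤ θ := hκθ
    · have h' : (4 * κ₀) * ((1 + τ) * γop) ≤ 0 := mul_nonpos_of_nonneg_of_nonpos (by linarith) hneg.le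
      have : 4 * κ₀ * (1 + τ) * γop = (4 * κ₀) * ((1 + τ) * γop) := by ring
      linarith
  -- (307)'s two bounds on `S ⊔ L = C`
  have hup := log_integral_allField_le hΓ hΓop hdiag hγ hfr hdisj hv hR hΔ hnbr hw hκ₀ hc₃ hh hstab hcub hκ hτ hθ0 hθ1 hκθ S L hSL ψ
    hψS hsmall₂
  have hlow := le_log_integral_allField hΓ hΓop hdiag hγ hfr hdisj hv hR hΔ hnbr hw hκ₀ hκ₀ hc₃ hh hstab hquad hcub hκ hτ hθ0 hθ1
    hκθ hκ₁θ S L hSL ψ hψS hsmall₁ hsmall₂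
  rw [hunion] at hup hlow
  -- nonnegativity of the densities and of the charge constant
  have h1θ : 0 < 1 - θ := by linarith
  have hA0 : 0 ≤ (1 - θ) ^ (-(κ * (1 + τ) * γ / (2 * θ))) := (rpow_pos_of_pos h1θ _).le
  have hE1 : 0 ≤ max (exp (c₃ * v * h ^ 3) - 1) (2 * exp (-((κ / 2 - κ₀) * h ^ 2))) := le_trans (by positivity) (le_max_right _ _)
  have hE2 : 0 ≤ max (exp (2 * c₃ * v * h ^ 3) - 1) (2 * exp (-((κ / 2 - 2 * κ₀) * h ^ 2))) :=
    le_trans (by positivity) (le_max_right _ _)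
  have hD1nn : 0 ≤ ((Δ : ℝ) + 1) * (2 * (Real.exp 1 * (((max (exp (c₃ * v * h ^ 3) - 1) (2 * exp (-((κ / 2 - κ₀) * h ^ 2)))) *
      exp (κ * (1 + τ⁻¹) * Ψ ^ 2 / 2)) * ((1 - θ) ^ (-(κ * (1 + τ) * γ / (2 * θ)))) ^ v))) := by positivity
  have hD2nn : 0 ≤ ((Δ : ℝ) + 1) * (2 * (Real.exp 1 * (((max (exp (2 * c₃ * v * h ^ 3) - 1)
      (2 * exp (-((κ / 2 - 2 * κ₀) * h ^ 2)))) * exp (κ * (1 + τ⁻¹) * Ψ ^ 2 / 2)) * ((1 - θ) ^ (-(κ * (1 + τ) * γ / (2 * θ)))) ^ v))) := by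
    positivity
  have hlog : 0 ≤ -log (1 - θ) := by rw [neg_nonneg]; exact log_nonpos h1θ.le (by linarith)
  have hc2nn : 0 ≤ (2 * (2 * κ₀) * (1 + τ) * γ / (2 * θ)) * (-log (1 - θ)) := by positivity
  -- the large-field charge, cell by cell: `#⋃L = Σ_{p∈L}#cell p`, `Σ_{⋃L}ψ² = Σ_{p∈L}Σ_{cell p}ψ²`
  have hpd : (L : Set V).PairwiseDisjoint cell := fun p _ q _ hpq => hdisj p q hpq
  have hcardY : ((L.biUnion cell).card : ℝ) = ∑ p ∈ L, ((cell p).card : ℝ) := by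
    rw [card_biUnion hpd, Nat.cast_sum]
  have hsumY : ∑ x ∈ L.biUnion cell, ψ x ^ 2 = ∑ p ∈ L, ∑ x ∈ cell p, ψ x ^ 2 :=
    (cellSum_eq_sum_biUnion cell hdisj L (fun x => ψ x ^ 2)).symm
  have hcharge : (1 / 2) * ((L.biUnion cell).card * (2 * (2 * κ₀) * (1 + τ) * γ / (2 * θ)) * (-log (1 - θ)) +
      2 * κ₀ * (1 + τ⁻¹) * ∑ x ∈ L.biUnion cell, ψ x ^ 2) ≤
      ∑ p ∈ L, ((1 / 2) * ((2 * (2 * κ₀) * (1 + τ) * γ / (2 * θ)) * (-log (1 - θ))) * v + κ₀ * (1 + τ⁻¹) * ∑ x ∈ cell p, ψ x ^ 2) := by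
    have hY1 : ((L.biUnion cell).card : ℝ) * (2 * (2 * κ₀) * (1 + τ) * γ / (2 * θ)) * (-log (1 - θ)) =
        ∑ p ∈ L, ((cell p).card : ℝ) * (2 * (2 * κ₀) * (1 + τ) * γ / (2 * θ)) * (-log (1 - θ)) := by
      rw [hcardY, sum_mul, sum_mul]
    have hY2 : 2 * κ₀ * (1 + τ⁻¹) * ∑ x ∈ L.biUnion cell, ψ x ^ 2 = ∑ p ∈ L, 2 * κ₀ * (1 + τ⁻¹) * ∑ x ∈ cell p, ψ x ^ 2 := by
      rw [hsumY, mul_sum]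
    rw [hY1, hY2, ← sum_add_distrib, mul_sum]
    refine sum_le_sum fun p _ => ?_
    have hvp : ((cell p).card : ℝ) ≤ v := by exact_mod_cast hv p
    have hcv := mul_le_mul_of_nonneg_right hvp hc2nn
    have hs0 : 0 ≤ ∑ x ∈ cell p, ψ x ^ 2 := sum_nonneg fun x _ => sq_nonneg _
    nlinarith [hcv, hs0]
  -- assemble
  have hSD1 := mul_le_mul_of_nonneg_right hSC hD1nn
  have hSD2 := mul_le_mul_of_nonneg_right hSC hD2nn
  have hSD1nn := mul_nonneg (Nat.cast_nonneg S.card) hD1nn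
  have hsum0 : 0 ≤ ∑ x ∈ L.biUnion cell, ψ x ^ 2 := sum_nonneg fun x _ => sq_nonneg _
  have hcard0 : 0 ≤ ((L.biUnion cell).card : ℝ) := Nat.cast_nonneg _
  have hchargenn : 0 ≤ (1 / 2) * ((L.biUnion cell).card * (2 * (2 * κ₀) * (1 + τ) * γ / (2 * θ)) * (-log (1 - θ)) +
      2 * κ₀ * (1 + τ⁻¹) * ∑ x ∈ L.biUnion cell, ψ x ^ 2) := by
    have h1 : 0 ≤ ((L.biUnion cell).card : ℝ) * (2 * (2 * κ₀) * (1 + τ) * γ / (2 * θ)) * (-log (1 - θ)) := by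
      rw [mul_assoc]; exact mul_nonneg hcard0 hc2nn
    have h2 : 0 ≤ 2 * κ₀ * (1 + τ⁻¹) * ∑ x ∈ L.biUnion cell, ψ x ^ 2 := by positivity
    linarith
  rw [abs_le]
  constructor
  · linarith [hcharge, hlow, hSD1, hSD2, hchargenn]
  · linarith [hcharge, hup, hSD1, hSD2, hSD1nn]

/-! ## §2. Exponentiating: the step in (308)'s resummed form -/

omit [Fintype ι] [DecidableEq ι] [DecidableEq V] [DecidableRel R] [Std.Symm R] in
/-- **The exponential of a charge on the large-field cells is dominated by the cell product** (`a ≥ 0` not needed, all terms real):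
`exp(Σ_{p∈C, ¬(Σ_{cell p}ψ²≤Ψ²)}(a + bΣ_{cell p}ψ²)) ≤ ∏_{p∈C}(1 + 1_{Ψ²≤Σ_{cell p}ψ²}·(e^{a}·e^{bΣ_{cell p}ψ²}))`. [folklore] -/
theorem exp_sum_filter_le_prod (C : Finset V) (ψ : EuclideanSpace ℝ ι) (a b : ℝ) :
    exp (∑ p ∈ C with ¬ (∑ x ∈ cell p, ψ x ^ 2 ≤ Ψ ^ 2), (a + b * ∑ x ∈ cell p, ψ x ^ 2)) ≤
      ∏ p ∈ C, (1 + (if Ψ ^ 2 ≤ ∑ x ∈ cell p, ψ x ^ 2 then (1 : ℝ) else 0) * (exp a * exp (b * ∑ x ∈ cell p, ψ x ^ 2))) := by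
  rw [exp_sum, prod_filter]
  refine prod_le_prod (fun p _ => by split_ifs <;> positivity) fun p _ => ?_
  by_cases hp : ¬ (∑ x ∈ cell p, ψ x ^ 2 ≤ Ψ ^ 2)
  · have hle : Ψ ^ 2 ≤ ∑ x ∈ cell p, ψ x ^ 2 := (lt_of_not_ge hp).le
    rw [if_pos hp, if_pos hle, one_mul, exp_add]
    linarith [mul_pos (exp_pos a) (exp_pos (b * ∑ x ∈ cell p, ψ x ^ 2))]
  · rw [if_neg hp]
    have : 0 ≤ (if Ψ ^ 2 ≤ ∑ x ∈ cell p, ψ x ^ 2 then (1 : ℝ) else 0) * (exp a * exp (b * ∑ x ∈ cell p, ψ x ^ 2)) := by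
      split_ifs <;> positivity
    linarith

/-- **THE STEP IN RESUMMED FORM** (`t ≥ 0`, hypotheses of §1):
`e^{t|log Z_ψ(C)|} ≤ e^{t(2d₁+½d₂)#C}·∏_{p∈C}(1 + 1_{Ψ²≤Σ_{cell p}ψ²}·e^{t·c₂v∕2}·e^{t·κ₀(1+τ⁻¹)·Σ_{cell p}ψ²})`. [folklore] -/
theorem exp_mul_abs_log_step_le (hΓ : Γ.PosSemidef) (hΓop : (γop • (1 : Matrix ι ι ℝ) - Γ).PosSemidef) (hdiag : ∀ i, Γ i i ≤ γ)
    (hγ : 0 ≤ γ) (hfr : HasFiniteRange dι ρ Γ) (hdisj : ∀ p q, p ≠ q → Disjoint (cell p) (cell q)) (hv : ∀ p, (cell p).card ≤ v)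
    (hR : ∀ (p p' : V) (x y : ι), x ∈ cell p → y ∈ cell p' → dι x y ≤ ρ → p = p' ∨ R p p')
    (hΔ : ∀ x, (nbr x).card ≤ Δ) (hnbr : ∀ x y, R x y → y ∈ nbr x) (hw : ∀ x, Measurable (w x)) (hκ₀ : 0 ≤ κ₀) (hc₃ : 0 ≤ c₃)
    (hh : 0 ≤ h) (hstab : ∀ x, ∀ t : ℝ, -(κ₀ * t ^ 2) ≤ w x t) (hquad : ∀ x, ∀ t : ℝ, w x t ≤ κ₀ * t ^ 2)
    (hcub : ∀ x, ∀ t : ℝ, |t| ≤ h → |w x t| ≤ c₃ * |t| ^ 3) (hκ : 4 * κ₀ ≤ κ) (hτ : 0 < τ) (hθ0 : 0 < θ) (hθ1 : θ < 1)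
    (hκθ : κ * (1 + τ) * γop ≤ θ)
    (hsmall₁ : Real.exp 1 * (((max (exp (c₃ * v * h ^ 3) - 1) (2 * exp (-((κ / 2 - κ₀) * h ^ 2)))) *
      exp (κ * (1 + τ⁻¹) * Ψ ^ 2 / 2)) * ((1 - θ) ^ (-(κ * (1 + τ) * γ / (2 * θ)))) ^ v) * ((Δ : ℝ) + 1) ^ 2 ≤ 1 / 2)
    (hsmall₂ : Real.exp 1 * (((max (exp (2 * c₃ * v * h ^ 3) - 1) (2 * exp (-((κ / 2 - 2 * κ₀) * h ^ 2)))) *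
      exp (κ * (1 + τ⁻¹) * Ψ ^ 2 / 2)) * ((1 - θ) ^ (-(κ * (1 + τ) * γ / (2 * θ)))) ^ v) * ((Δ : ℝ) + 1) ^ 2 ≤ 1 / 2)
    (C : Finset V) (ψ : EuclideanSpace ℝ ι) {t : ℝ} (ht : 0 ≤ t) :
    exp (t * |log (∫ ω : EuclideanSpace ℝ ι, exp (-(∑ p ∈ C, ∑ x ∈ cell p, w x (ω x + ψ x))) ∂(multivariateGaussian 0 Γ))|) ≤
      exp (t * (C.card * (2 * (((Δ : ℝ) + 1) * (2 * (Real.exp 1 * (((max (exp (c₃ * v * h ^ 3) - 1)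
          (2 * exp (-((κ / 2 - κ₀) * h ^ 2)))) * exp (κ * (1 + τ⁻¹) * Ψ ^ 2 / 2)) * ((1 - θ) ^ (-(κ * (1 + τ) * γ / (2 * θ)))) ^ v)))) +
        (1 / 2) * (((Δ : ℝ) + 1) * (2 * (Real.exp 1 * (((max (exp (2 * c₃ * v * h ^ 3) - 1)
          (2 * exp (-((κ / 2 - 2 * κ₀) * h ^ 2)))) * exp (κ * (1 + τ⁻¹) * Ψ ^ 2 / 2)) *
          ((1 - θ) ^ (-(κ * (1 + τ) * γ / (2 * θ)))) ^ v))))))) *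
      ∏ p ∈ C, (1 + (if Ψ ^ 2 ≤ ∑ x ∈ cell p, ψ x ^ 2 then (1 : ℝ) else 0) *
        (exp (t * ((1 / 2) * ((2 * (2 * κ₀) * (1 + τ) * γ / (2 * θ)) * (-log (1 - θ))) * v)) *
          exp ((t * (κ₀ * (1 + τ⁻¹))) * ∑ x ∈ cell p, ψ x ^ 2))) := by
  have h := abs_log_step_le hΓ hΓop hdiag hγ hfr hdisj hv hR hΔ hnbr hw hκ₀ hc₃ hh hstab hquad hcub hκ hτ hθ0 hθ1 hκθ hsmall₁
    hsmall₂ C ψ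
  have h' := mul_le_mul_of_nonneg_left h ht
  rw [mul_add] at h'
  refine (exp_le_exp.2 h').trans ?_
  rw [exp_add]
  refine mul_le_mul_of_nonneg_left ?_ (exp_pos _).le
  rw [mul_sum]
  have hrw : ∑ p ∈ C with ¬ (∑ x ∈ cell p, ψ x ^ 2 ≤ Ψ ^ 2),
      t * ((1 / 2) * ((2 * (2 * κ₀) * (1 + τ) * γ / (2 * θ)) * (-log (1 - θ))) * v + κ₀ * (1 + τ⁻¹) * ∑ x ∈ cell p, ψ x ^ 2) =
      ∑ p ∈ C with ¬ (∑ x ∈ cell p, ψ x ^ 2 ≤ Ψ ^ 2),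
      (t * ((1 / 2) * ((2 * (2 * κ₀) * (1 + τ) * γ / (2 * θ)) * (-log (1 - θ))) * v) +
        (t * (κ₀ * (1 + τ⁻¹))) * ∑ x ∈ cell p, ψ x ^ 2) := sum_congr rfl fun p _ => by ring
  rw [hrw]
  exact exp_sum_filter_le_prod C ψ _ _

/-! ## §3. Measurability and integrability at the next scale -/

omit [DecidableEq V] [DecidableRel R] [Std.Symm R] in
/-- **`ψ ↦ Z_ψ(C)` is measurable** (the integrand is jointly measurable in `(ψ, ω)`; Fubini measurability of the partial integral).
[folklore] -/
theorem measurable_step (Γ : Matrix ι ι ℝ) (cell : V → Finset ι) (w : ι → ℝ → ℝ) (hw : ∀ x, Measurable (w x)) (C : Finset V) :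
    Measurable fun ψ : EuclideanSpace ℝ ι =>
      ∫ ω : EuclideanSpace ℝ ι, exp (-(∑ p ∈ C, ∑ x ∈ cell p, w x (ω x + ψ x))) ∂(multivariateGaussian 0 Γ) := by
  have hF : Measurable fun q : EuclideanSpace ℝ ι × EuclideanSpace ℝ ι =>
      exp (-(∑ p ∈ C, ∑ x ∈ cell p, w x (q.2 x + q.1 x))) := by
    refine measurable_exp.comp (Finset.measurable_sum C fun p _ => Finset.measurable_sum (cell p) fun x _ => ?_).neg
    exact (hw x).comp (((by fun_prop : Measurable fun ω : EuclideanSpace ℝ ι => ω x).comp measurable_snd).add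
      ((by fun_prop : Measurable fun ω : EuclideanSpace ℝ ι => ω x).comp measurable_fst))
  exact (hF.stronglyMeasurable.integral_prod_right' (ν := multivariateGaussian 0 Γ)).measurable

omit [DecidableRel R] [Std.Symm R] in
/-- (308)'s resummed cell product is integrable under `N(0,Γ')` (`Γ' ⪰ 0`, `Γ' ⪯ γ'_op·1`, `0 ≤ κ'`, `κ'γ'_op ≤ θ' < 1`, `b ≤ κ'∕2`). [folklore] -/
theorem integrable_prod_one_add_cellWeight {Γ' : Matrix ι ι ℝ} {γop' : ℝ} (hΓ' : Γ'.PosSemidef)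
    (hΓop' : (γop' • (1 : Matrix ι ι ℝ) - Γ').PosSemidef) (hdisj : ∀ p q, p ≠ q → Disjoint (cell p) (cell q)) {κ' θ' b : ℝ}
    (hκ' : 0 ≤ κ') (hθ1' : θ' < 1) (hκθ' : κ' * γop' ≤ θ') (hb : b ≤ κ' / 2) (C : Finset V) (Ψ a : ℝ) :
    Integrable (fun ω : EuclideanSpace ℝ ι => ∏ p ∈ C, (1 + (if Ψ ^ 2 ≤ ∑ x ∈ cell p, ω x ^ 2 then (1 : ℝ) else 0) *
      (exp a * exp (b * ∑ x ∈ cell p, ω x ^ 2)))) (multivariateGaussian 0 Γ') := by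
  simp_rw [prod_one_add]
  exact integrable_finsetSum _ fun L _ => integrable_prod_cellWeight hΓ' hΓop' cell hdisj hκ' hθ1' hκθ' hb L Ψ a

/-- **The moment's integrand is integrable at the next scale** (hypotheses of §1; `Γ' ⪰ 0`, `Γ' ⪯ γ'_op·1`, `0 ≤ κ'`, `κ'γ'_op ≤ θ' < 1`;
`0 ≤ t`, `tκ₀(1+τ⁻¹) ≤ κ'∕2`): measurable by `measurable_step`, dominated by §2's integrable product. [folklore] -/
theorem integrable_exp_mul_abs_log_step (hΓ : Γ.PosSemidef) (hΓop : (γop • (1 : Matrix ι ι ℝ) - Γ).PosSemidef)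
    (hdiag : ∀ i, Γ i i ≤ γ) (hγ : 0 ≤ γ) (hfr : HasFiniteRange dι ρ Γ) (hdisj : ∀ p q, p ≠ q → Disjoint (cell p) (cell q))
    (hv : ∀ p, (cell p).card ≤ v) (hR : ∀ (p p' : V) (x y : ι), x ∈ cell p → y ∈ cell p' → dι x y ≤ ρ → p = p' ∨ R p p')
    (hΔ : ∀ x, (nbr x).card ≤ Δ) (hnbr : ∀ x y, R x y → y ∈ nbr x) (hw : ∀ x, Measurable (w x)) (hκ₀ : 0 ≤ κ₀) (hc₃ : 0 ≤ c₃)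
    (hh : 0 ≤ h) (hstab : ∀ x, ∀ t : ℝ, -(κ₀ * t ^ 2) ≤ w x t) (hquad : ∀ x, ∀ t : ℝ, w x t ≤ κ₀ * t ^ 2)
    (hcub : ∀ x, ∀ t : ℝ, |t| ≤ h → |w x t| ≤ c₃ * |t| ^ 3) (hκ : 4 * κ₀ ≤ κ) (hτ : 0 < τ) (hθ0 : 0 < θ) (hθ1 : θ < 1)
    (hκθ : κ * (1 + τ) * γop ≤ θ)
    (hsmall₁ : Real.exp 1 * (((max (exp (c₃ * v * h ^ 3) - 1) (2 * exp (-((κ / 2 - κ₀) * h ^ 2)))) *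
      exp (κ * (1 + τ⁻¹) * Ψ ^ 2 / 2)) * ((1 - θ) ^ (-(κ * (1 + τ) * γ / (2 * θ)))) ^ v) * ((Δ : ℝ) + 1) ^ 2 ≤ 1 / 2)
    (hsmall₂ : Real.exp 1 * (((max (exp (2 * c₃ * v * h ^ 3) - 1) (2 * exp (-((κ / 2 - 2 * κ₀) * h ^ 2)))) *
      exp (κ * (1 + τ⁻¹) * Ψ ^ 2 / 2)) * ((1 - θ) ^ (-(κ * (1 + τ) * γ / (2 * θ)))) ^ v) * ((Δ : ℝ) + 1) ^ 2 ≤ 1 / 2)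
    {Γ' : Matrix ι ι ℝ} {γop' : ℝ} (hΓ' : Γ'.PosSemidef) (hΓop' : (γop' • (1 : Matrix ι ι ℝ) - Γ').PosSemidef) {κ' θ' t : ℝ}
    (hκ' : 0 ≤ κ') (hθ1' : θ' < 1) (hκθ' : κ' * γop' ≤ θ') (ht : 0 ≤ t) (htb : t * (κ₀ * (1 + τ⁻¹)) ≤ κ' / 2) (C : Finset V) :
    Integrable (fun ψ : EuclideanSpace ℝ ι =>
      exp (t * |log (∫ ω : EuclideanSpace ℝ ι, exp (-(∑ p ∈ C, ∑ x ∈ cell p, w x (ω x + ψ x))) ∂(multivariateGaussian 0 Γ))|))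
      (multivariateGaussian 0 Γ') := by
  have hmeas : Measurable fun ψ : EuclideanSpace ℝ ι =>
      exp (t * |log (∫ ω : EuclideanSpace ℝ ι, exp (-(∑ p ∈ C, ∑ x ∈ cell p, w x (ω x + ψ x))) ∂(multivariateGaussian 0 Γ))|) :=
    measurable_exp.comp (((measurable_log.comp (measurable_step Γ cell w hw C)).abs).const_mul t)
  have hdom := (integrable_prod_one_add_cellWeight hΓ' hΓop' hdisj hκ' hθ1' hκθ' htb C Ψ
    (t * ((1 / 2) * ((2 * (2 * κ₀) * (1 + τ) * γ / (2 * θ)) * (-log (1 - θ))) * v))).const_mul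
    (exp (t * (C.card * (2 * (((Δ : ℝ) + 1) * (2 * (Real.exp 1 * (((max (exp (c₃ * v * h ^ 3) - 1)
          (2 * exp (-((κ / 2 - κ₀) * h ^ 2)))) * exp (κ * (1 + τ⁻¹) * Ψ ^ 2 / 2)) * ((1 - θ) ^ (-(κ * (1 + τ) * γ / (2 * θ)))) ^ v)))) +
        (1 / 2) * (((Δ : ℝ) + 1) * (2 * (Real.exp 1 * (((max (exp (2 * c₃ * v * h ^ 3) - 1)
          (2 * exp (-((κ / 2 - 2 * κ₀) * h ^ 2)))) * exp (κ * (1 + τ⁻¹) * Ψ ^ 2 / 2)) *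
          ((1 - θ) ^ (-(κ * (1 + τ) * γ / (2 * θ)))) ^ v))))))))
  refine hdom.mono' hmeas.aestronglyMeasurable (ae_of_all _ fun ψ => ?_)
  rw [Real.norm_of_nonneg (exp_pos _).le]
  exact exp_mul_abs_log_step_le hΓ hΓop hdiag hγ hfr hdisj hv hR hΔ hnbr hw hκ₀ hc₃ hh hstab hquad hcub hκ hτ hθ0 hθ1 hκθ hsmall₁
    hsmall₂ C ψ ht

/-! ## §4. THE END: the two-scale theorem -/

/-- **THE END — THE LOGARITHM OF THE FLUCTUATION STEP HAS AN EXTENSIVE EXPONENTIAL MOMENT UNDER THE NEXT GAUSSIAN.**  Fluctuation scale: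
`Γ ⪰ 0` of range `ρ`, `Γ ⪯ γ_op·1`, diagonal `≤ γ` (`γ ≥ 0`); disjoint cells of `≤ v` sites; `R` symmetric covering `ρ`-closeness with `≤ Δ`
neighbours; measurable remainders with `|w_x(t)| ≤ κ₀t²` (`κ₀ ≥ 0`) and `|w_x(t)| ≤ c₃|t|³` for `|t| ≤ h` (`c₃, h ≥ 0`); `4κ₀ ≤ κ`, `0 < τ`,
`0 < θ < 1`, `κ(1+τ)γ_op ≤ θ`; (307)'s smallness at couplings `1, 2` with threshold `Ψ`.  Next scale: `Γ' ⪰ 0`, `Γ' ⪯ γ'_op·1`, diagonal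
`≤ γ'` (`γ' ≥ 0`), `0 ≤ κ'`, `0 < θ' < 1`, `κ'γ'_op ≤ θ'`; moment order `0 ≤ t` with `tκ₀(1+τ⁻¹) ≤ κ'∕2` ⟹ for every finite cell set `C`:
`∫ e^{t|log Z_ψ(C)|} dN(0,Γ')(ψ) ≤ exp(#C·(t·(2d₁ + ½d₂) + e^{t·c₂v∕2}·e^{−(κ'∕2 − tκ₀(1+τ⁻¹))Ψ²}·A'^v))`,
`d_s = (Δ+1)·2e·ε_sA_τ^v`, `c₂ = (4κ₀(1+τ)γ∕(2θ))(−log(1−θ))`, `A' = (1−θ')^{−κ'γ'∕(2θ')}` — extensive, no volume factor. [folklore] -/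
theorem integral_exp_mul_abs_log_step_le (hΓ : Γ.PosSemidef) (hΓop : (γop • (1 : Matrix ι ι ℝ) - Γ).PosSemidef)
    (hdiag : ∀ i, Γ i i ≤ γ) (hγ : 0 ≤ γ) (hfr : HasFiniteRange dι ρ Γ) (hdisj : ∀ p q, p ≠ q → Disjoint (cell p) (cell q))
    (hv : ∀ p, (cell p).card ≤ v) (hR : ∀ (p p' : V) (x y : ι), x ∈ cell p → y ∈ cell p' → dι x y ≤ ρ → p = p' ∨ R p p')
    (hΔ : ∀ x, (nbr x).card ≤ Δ) (hnbr : ∀ x y, R x y → y ∈ nbr x) (hw : ∀ x, Measurable (w x)) (hκ₀ : 0 ≤ κ₀) (hc₃ : 0 ≤ c₃)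
    (hh : 0 ≤ h) (hstab : ∀ x, ∀ t : ℝ, -(κ₀ * t ^ 2) ≤ w x t) (hquad : ∀ x, ∀ t : ℝ, w x t ≤ κ₀ * t ^ 2)
    (hcub : ∀ x, ∀ t : ℝ, |t| ≤ h → |w x t| ≤ c₃ * |t| ^ 3) (hκ : 4 * κ₀ ≤ κ) (hτ : 0 < τ) (hθ0 : 0 < θ) (hθ1 : θ < 1)
    (hκθ : κ * (1 + τ) * γop ≤ θ)
    (hsmall₁ : Real.exp 1 * (((max (exp (c₃ * v * h ^ 3) - 1) (2 * exp (-((κ / 2 - κ₀) * h ^ 2)))) *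
      exp (κ * (1 + τ⁻¹) * Ψ ^ 2 / 2)) * ((1 - θ) ^ (-(κ * (1 + τ) * γ / (2 * θ)))) ^ v) * ((Δ : ℝ) + 1) ^ 2 ≤ 1 / 2)
    (hsmall₂ : Real.exp 1 * (((max (exp (2 * c₃ * v * h ^ 3) - 1) (2 * exp (-((κ / 2 - 2 * κ₀) * h ^ 2)))) *
      exp (κ * (1 + τ⁻¹) * Ψ ^ 2 / 2)) * ((1 - θ) ^ (-(κ * (1 + τ) * γ / (2 * θ)))) ^ v) * ((Δ : ℝ) + 1) ^ 2 ≤ 1 / 2)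
    {Γ' : Matrix ι ι ℝ} {γop' γ' : ℝ} (hΓ' : Γ'.PosSemidef) (hΓop' : (γop' • (1 : Matrix ι ι ℝ) - Γ').PosSemidef)
    (hdiag' : ∀ i, Γ' i i ≤ γ') (hγ' : 0 ≤ γ') {κ' θ' t : ℝ} (hκ' : 0 ≤ κ') (hθ0' : 0 < θ') (hθ1' : θ' < 1) (hκθ' : κ' * γop' ≤ θ')
    (ht : 0 ≤ t) (htb : t * (κ₀ * (1 + τ⁻¹)) ≤ κ' / 2) (C : Finset V) :
    ∫ ψ : EuclideanSpace ℝ ι,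
        exp (t * |log (∫ ω : EuclideanSpace ℝ ι, exp (-(∑ p ∈ C, ∑ x ∈ cell p, w x (ω x + ψ x))) ∂(multivariateGaussian 0 Γ))|)
        ∂(multivariateGaussian 0 Γ') ≤
      exp (C.card * (t * (2 * (((Δ : ℝ) + 1) * (2 * (Real.exp 1 * (((max (exp (c₃ * v * h ^ 3) - 1)
          (2 * exp (-((κ / 2 - κ₀) * h ^ 2)))) * exp (κ * (1 + τ⁻¹) * Ψ ^ 2 / 2)) * ((1 - θ) ^ (-(κ * (1 + τ) * γ / (2 * θ)))) ^ v)))) +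
        (1 / 2) * (((Δ : ℝ) + 1) * (2 * (Real.exp 1 * (((max (exp (2 * c₃ * v * h ^ 3) - 1)
          (2 * exp (-((κ / 2 - 2 * κ₀) * h ^ 2)))) * exp (κ * (1 + τ⁻¹) * Ψ ^ 2 / 2)) *
          ((1 - θ) ^ (-(κ * (1 + τ) * γ / (2 * θ)))) ^ v))))) +
        exp (t * ((1 / 2) * ((2 * (2 * κ₀) * (1 + τ) * γ / (2 * θ)) * (-log (1 - θ))) * v)) *
          (exp (-((κ' / 2 - t * (κ₀ * (1 + τ⁻¹))) * Ψ ^ 2)) * ((1 - θ') ^ (-(κ' * γ' / (2 * θ')))) ^ v))) := by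
  set μ' := multivariateGaussian 0 Γ' with hμ'
  set D : ℝ := 2 * (((Δ : ℝ) + 1) * (2 * (Real.exp 1 * (((max (exp (c₃ * v * h ^ 3) - 1)
      (2 * exp (-((κ / 2 - κ₀) * h ^ 2)))) * exp (κ * (1 + τ⁻¹) * Ψ ^ 2 / 2)) * ((1 - θ) ^ (-(κ * (1 + τ) * γ / (2 * θ)))) ^ v)))) +
    (1 / 2) * (((Δ : ℝ) + 1) * (2 * (Real.exp 1 * (((max (exp (2 * c₃ * v * h ^ 3) - 1)
      (2 * exp (-((κ / 2 - 2 * κ₀) * h ^ 2)))) * exp (κ * (1 + τ⁻¹) * Ψ ^ 2 / 2)) *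
      ((1 - θ) ^ (-(κ * (1 + τ) * γ / (2 * θ)))) ^ v)))) with hD
  set a : ℝ := t * ((1 / 2) * ((2 * (2 * κ₀) * (1 + τ) * γ / (2 * θ)) * (-log (1 - θ))) * v) with ha
  set b : ℝ := t * (κ₀ * (1 + τ⁻¹)) with hb
  have hint := integrable_prod_one_add_cellWeight hΓ' hΓop' hdisj hκ' hθ1' hκθ' htb C Ψ a
  have hres := integral_prod_one_add_cellWeight_le_exp hΓ' hΓop' hdiag' hγ' cell hdisj hv hκ' hθ0' hθ1' hκθ' htb C Ψ a
  calc ∫ ψ : EuclideanSpace ℝ ι, exp (t * |log (∫ ω : EuclideanSpace ℝ ι, exp (-(∑ p ∈ C, ∑ x ∈ cell p, w x (ω x + ψ x)))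
          ∂(multivariateGaussian 0 Γ))|) ∂μ'
      ≤ ∫ ψ : EuclideanSpace ℝ ι, exp (t * (C.card * D)) * ∏ p ∈ C, (1 + (if Ψ ^ 2 ≤ ∑ x ∈ cell p, ψ x ^ 2 then (1 : ℝ) else 0) *
          (exp a * exp (b * ∑ x ∈ cell p, ψ x ^ 2))) ∂μ' :=
        integral_mono_of_nonneg (ae_of_all _ fun ψ => (exp_pos _).le) (hint.const_mul _) (ae_of_all _ fun ψ =>
          exp_mul_abs_log_step_le hΓ hΓop hdiag hγ hfr hdisj hv hR hΔ hnbr hw hκ₀ hc₃ hh hstab hquad hcub hκ hτ hθ0 hθ1 hκθ hsmall₁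
            hsmall₂ C ψ ht)
    _ = exp (t * (C.card * D)) * ∫ ψ : EuclideanSpace ℝ ι, ∏ p ∈ C, (1 + (if Ψ ^ 2 ≤ ∑ x ∈ cell p, ψ x ^ 2 then (1 : ℝ) else 0) *
          (exp a * exp (b * ∑ x ∈ cell p, ψ x ^ 2))) ∂μ' := integral_const_mul _ _
    _ ≤ exp (t * (C.card * D)) * exp (C.card * (exp a * (exp (-((κ' / 2 - b) * Ψ ^ 2)) * ((1 - θ') ^ (-(κ' * γ' / (2 * θ')))) ^ v))) :=
        mul_le_mul_of_nonneg_left hres (exp_pos _).le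
    _ = exp (C.card * (t * D + exp a * (exp (-((κ' / 2 - b) * Ψ ^ 2)) * ((1 - θ') ^ (-(κ' * γ' / (2 * θ')))) ^ v))) := by
        rw [← exp_add]
        congr 1
        ring

end Step

/-! ## §5. Toy -/

/-- Toy (§2): with NO cells the charge is empty and the product is empty: `e^0 ≤ 1`. -/
example (cell : Unit → Finset (Fin 1)) (ψ : EuclideanSpace ℝ (Fin 1)) (a b Ψ : ℝ) :
    exp (∑ p ∈ (∅ : Finset Unit) with ¬ (∑ x ∈ cell p, ψ x ^ 2 ≤ Ψ ^ 2), (a + b * ∑ x ∈ cell p, ψ x ^ 2)) ≤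
      ∏ p ∈ (∅ : Finset Unit), (1 + (if Ψ ^ 2 ≤ ∑ x ∈ cell p, ψ x ^ 2 then (1 : ℝ) else 0) * (exp a * exp (b * ∑ x ∈ cell p, ψ x ^ 2))) :=
  exp_sum_filter_le_prod (cell := cell) (Ψ := Ψ) ∅ ψ a b

end Summit.QuantumFields.BalabanUV.T4Continuum.NE7b.SupStepExponentialMoments
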